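import Summits.BirchSwinnertonDyer.Rank1Residual.X11b.AnticyclotomicEulerChar
import Summits.BirchSwinnertonDyer.Rank1Residual.X11b.AnticyclotomicModuleFinite
import Summits.BirchSwinnertonDyer.Rank1Residual.X11b.AnticyclotomicLogLinks
import HarnessLib

/-!
# X11b, route R1 — the two tree-object links (CTL) and (IMC∘BDP)@`𝟙` in EULER-CHARACTERISTIC FORM

HONEST FRAMING (cell `b2b-bsdres`, run/shared/lean/b2b/bsd-rank1-residual/, verbatim in every
file): the goal of the cell is to DELETE the COMBINATION-SHAPED residual classes of the
Birch–Swinnerton-Dyer formula for ALL analytic-rank `≤ 1` elliptic curves over `ℚ` — "full BSD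
formula for every rank `≤ 1` curve in class `C`" assembled STRICTLY from published theorems — so
that the rank-`≤ 1` remainder becomes exactly the CONSTRUCTION-SHAPED classes, which are TYPED
(missing-input `Prop`s), NOT attempted. This is not "finishing BSD". Sub-cell
`b2b-bsdres-multr1-p1` (X11b, route R1 = Castella 2018 Thm. A re-proved along the author's
erratum); a RESEARCH ROUTE; no claim beyond the stated class; X11b stays CONSTRUCTION-SHAPED;
nothing here changes a label; no named fact is minted (theorems only; no `sorry`).

## Content

**The two links of the statement of record in Euler-characteristic form.** By
   `XAc.hasCharValuationAt_iff_card` (`AnticyclotomicEulerChar.lean`) and `XAc.module_finite_empty`,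
   at every datum `(κ, γ, 𝔭, ι, P)`:
   * `imcWaldspurgerOnTreeAt_iff_card`: the OPEN link (IMC∘BDP)@`𝟙` — "`ord_p f_ac(0) =
     2(ord_p log_ω P − 1)`" — holds IFF `Sel_𝔭(K_∞, E[p^∞])^γ` is finite and
     **`#Sel_𝔭(K_∞, E[p^∞])^γ = p^{2(ord_p log_ω P − 1)} · #Sel_𝔭(K_∞, E[p^∞])_γ`** (with
     `2(ord_p log_ω P − 1) ≥ 0`);
   * `controlOnTreeAt_iff_card`: the PUB-shaped link (CTL) = Cas18 Thm. 2.3 holds IFF `Sel^γ` is finite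
     and `#Sel^γ = p^n · #Sel_γ` with `n = ord_p #Ш(E/K)[p^∞] + 2((ord_p log_ω P − 1) − ord_p[E(K):ℤP])
     + ord_p ∏_{w∣N⁺} c_w` — the Euler-characteristic form `χ(Γ, Sel_𝔭(K_∞, E[p^∞])) = #Ш_BDP · (…)²`
     in which Jetchev–Skinner–Wan PROVE the anticyclotomic control theorem (JSW17 Thm. 3.3.1 =
     arXiv:1512.06894 Thm. 8: §3.3.5 "`H¹_{𝔉^Σ}(K, M)^Γ` has finite order. Hence `X^Σ_ac(M)_Γ` … has
     finite order. It follows easily that `X^Σ_ac(M)` must therefore be `Λ`-torsion" — the torsion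
     criterion; §3.3.6 determines `#𝒪/f_ac^Σ(0)` from `#H¹_{𝔉^Σ}(K, M)^Γ` and `H¹_{𝔉^Σ}(K, M)_Γ = 0`).
   So route R1's ONE open input `R1OpenInputOnTreeAt` and its PUB-shaped companion
   `R1ControlOnTreeAt` are, datum by datum, statements about the two finite groups
   `H⁰(Γ, Sel_𝔭(K_∞, E[p^∞]))`, `H¹(Γ, Sel_𝔭(K_∞, E[p^∞]))` of Castella's Selmer group — no
   characteristic ideal, no power series, no choice of generator (class level:
   `r1OpenInputOnTreeAt_iff_card`, `r1ControlOnTreeAt_iff_card`).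

Nothing is asserted; the links stay hypotheses (one OPEN, one PUB-shaped); X11b CONSTRUCTION-SHAPED.

References: [Castella2018] Thm. 2.3, §5 (5.1) (arXiv:1704.06608 pp. 5, 12); [Castella2018Erratum]
Thm. 1.1 and p. 4; [JetchevSkinnerWan2017] §3.3, Thm. 3.3.1; [GreenbergLNM1716] §4 Lemma 4.2.
-/

noncomputable section

open scoped Classical

open WeierstrassCurve NumberField IsDedekindDomain Literature.NumberTheory.EllipticCurves
  Literature.NumberTheory.EllipticCurves.ModularForms
  Literature.NumberTheory.EllipticCurves.Rank1Residual
  Literature.NumberTheory.EllipticCurves.Rank1Residual.Typed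
  Summit.BirchSwinnertonDyer.Rank1Residual.X11b.AcSelmer

namespace Summit.BirchSwinnertonDyer.Rank1Residual.X11b

/-! ### The two tree-object links in Euler-characteristic form -/

section BaseChange

variable {W : WeierstrassCurve ℚ} [W.IsElliptic] {K : Type} [Field K] [NumberField K]
variable (p : ℕ) [Fact p.Prime] (κ : ZpExtension K p) (𝔭 : HeightOneSpectrum (𝓞 K))
  (γ : Field.absoluteGaloisGroup K) [Fact (κ.IsTopGenerator γ)]

/-- `X_ac(E_K[p^∞])` is finitely generated over `Λ` for the base change `E_K` of an elliptic `E/ℚ`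
(`XAc.module_finite_empty`, instance plumbing through `baseChange = map`). [cite: Castella2018, §2.1 (arXiv:1704.06608 p. 5)] -/
theorem module_finite_XAc_baseChange :
    Module.Finite (IwasawaAlgebra p) (XAc (W.baseChange K) p κ 𝔭 ∅ γ) := by
  haveI : (W.baseChange K).IsElliptic := by rw [WeierstrassCurve.baseChange]; infer_instance
  exact XAc.module_finite_empty κ 𝔭 γ

omit [W.IsElliptic] in
/-- **The torsion-and-`f(0) ≠ 0` half of both links is Greenberg's criterion**: at a datum, as soon as
`Sel_𝔭(K_∞, E[p^∞])^γ` is finite, `X_ac(E[p^∞])` is `Λ`-torsion with `ord_p f_ac(0)` DEFINED (some `n`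
with `XAc.HasCharValuationAt … n`); what the two links then assert is only the VALUE of `n`
(`XAc.exists_hasCharValuationAt_of_finite`). [cite: GreenbergLNM1716, §1 p. 60 and §4 Lemma 4.2] -/
theorem exists_hasCharValuationAt_of_finite_invariants
    (hinv : Finite (IwasawaDual.endInvariants (conjSelmerAc (W.baseChange K) p κ 𝔭 ∅ γ - 1))) :
    ∃ n : ℕ, XAc.HasCharValuationAt (W.baseChange K) p κ 𝔭 ∅ γ n :=
  XAc.exists_hasCharValuationAt_of_finite (W.baseChange K) p κ 𝔭 ∅ γ hinv


/-- **When `Sel_γ = 0`** (as JSW prove at their data: arXiv:1512.06894 §3.3, `H¹_{𝔉^Σ}(K, M)_Γ = 0`),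
the Euler-characteristic form of "`ord_p f_ac(0) = n`" at a datum reads simply `#Sel_𝔭(K_∞, E[p^∞])^γ = p^n`.
[cite: JetchevSkinnerWan2017, §3.3 (proof of Thm. 3.3.1) (shape only; nothing asserted)] [cite: GreenbergLNM1716, §4 Lemma 4.2 (p. 102)] -/
theorem hasCharValuationAt_iff_card_of_subsingleton_coinvariants
    [Subsingleton (IwasawaDual.EndCoinvariants (conjSelmerAc (W.baseChange K) p κ 𝔭 ∅ γ - 1))]
    (n : ℕ) :
    XAc.HasCharValuationAt (W.baseChange K) p κ 𝔭 ∅ γ n ↔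
      ∃ _ : Finite (IwasawaDual.endInvariants (conjSelmerAc (W.baseChange K) p κ 𝔭 ∅ γ - 1)),
        Nat.card (IwasawaDual.endInvariants (conjSelmerAc (W.baseChange K) p κ 𝔭 ∅ γ - 1)) =
          p ^ n := by
  haveI := module_finite_XAc_baseChange p κ 𝔭 γ (W := W)
  rw [XAc.hasCharValuationAt_iff_card,
    Nat.card_of_subsingleton
      (0 : IwasawaDual.EndCoinvariants (conjSelmerAc (W.baseChange K) p κ 𝔭 ∅ γ - 1)),
    mul_one]

end BaseChange

section Links

variable {W : WeierstrassCurve ℚ} [W.IsElliptic] [W.IsGloballyMinimal] {K : Type} [Field K]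
  [NumberField K]
variable (p : ℕ) [Fact p.Prime] (κ : ZpExtension K p) (𝔭 : HeightOneSpectrum (𝓞 K))
  (γ : Field.absoluteGaloisGroup K) [Fact (κ.IsTopGenerator γ)] (ι : K →+* ℚ_[p])

/-- **(IMC∘BDP)@`𝟙` in Euler-characteristic form.** At a datum `(κ, γ, 𝔭, ι, P)`, the OPEN tree-object
link `IMCWaldspurgerOnTreeAt` ("`ord_p f_ac(0) = 2·(ord_p log_ω P − 1)`", erratum Thm. 1.1 at `𝟙` ∘
Cas18 Thm. 3.2) holds IF AND ONLY IF there is `n : ℕ` with `n = 2(ord_p log_ω P − 1)` such that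
`Sel_𝔭(K_∞, E[p^∞])^γ` is finite and `#Sel_𝔭(K_∞, E[p^∞])^γ = p^n · #Sel_𝔭(K_∞, E[p^∞])_γ`
(`XAc.hasCharValuationAt_iff_card`, `XAc.module_finite_empty`). The open input is an identity between
the orders of `H⁰(Γ, ·)` and `H¹(Γ, ·)` of Castella's Selmer group; no `Λ`-structure, characteristic
ideal or generator is mentioned on the right. [claim: Castella2018Erratum, status: under-review]
[cite: Castella2018, Thm. 3.2 (arXiv:1704.06608 p. 9) and §5 (5.1) (p. 12) (shape only; nothing asserted)] [cite: GreenbergLNM1716, §4 Lemma 4.2 (p. 102)] -/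
theorem imcWaldspurgerOnTreeAt_iff_card (P : (W.baseChange K).toAffine.Point) :
    IMCWaldspurgerOnTreeAt p κ 𝔭 γ ι P ↔
      ∃ n : ℕ, (∃ _ : Finite (IwasawaDual.endInvariants
            (conjSelmerAc (W.baseChange K) p κ 𝔭 ∅ γ - 1)),
          Nat.card (IwasawaDual.endInvariants (conjSelmerAc (W.baseChange K) p κ 𝔭 ∅ γ - 1)) =
            p ^ n * Nat.card (IwasawaDual.EndCoinvariants
              (conjSelmerAc (W.baseChange K) p κ 𝔭 ∅ γ - 1))) ∧
        (n : ℤ) = 2 * (padicLogOrd W p ι P - 1) := by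
  haveI := module_finite_XAc_baseChange p κ 𝔭 γ (W := W)
  unfold IMCWaldspurgerOnTreeAt
  simp only [XAc.hasCharValuationAt_iff_card]

/-- **(CTL) = Cas18 Thm. 2.3 in Euler-characteristic form.** At a datum `(κ, γ, 𝔭, ι, P)`, the
PUB-shaped tree-object link `ControlOnTreeAt` holds IF AND ONLY IF there is `n : ℕ` with
`n = ord_p #Ш(E/K)[p^∞] + 2·((ord_p log_ω P − 1) − ord_p[E(K):ℤP]) + ord_p ∏_{w∣N⁺} c_w(E/K)` such that
`Sel_𝔭(K_∞, E[p^∞])^γ` is finite and `#Sel_𝔭(K_∞, E[p^∞])^γ = p^n · #Sel_𝔭(K_∞, E[p^∞])_γ` — the form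
`χ(Γ, Sel) = #H⁰(Γ, Sel)/#H¹(Γ, Sel)` in which JSW17 §3.3 proves the anticyclotomic control theorem
(arXiv:1512.06894 §3.3.5: torsion from `#X_Γ < ∞`; §3.3.6: `#𝒪/f(0)` from `#Sel^Γ`, with `Sel_Γ = 0`).
[cite: Castella2018, Thm. 2.3 (arXiv:1704.06608 p. 5) (shape only; nothing asserted)] [cite: JetchevSkinnerWan2017, Thm. 3.3.1 (shape only; nothing asserted)] [cite: GreenbergLNM1716, §4 Lemma 4.2 (p. 102)] -/
theorem controlOnTreeAt_iff_card (P : (W.baseChange K).toAffine.Point) :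
    ControlOnTreeAt p κ 𝔭 γ ι P ↔
      ∃ n : ℕ, (∃ _ : Finite (IwasawaDual.endInvariants
            (conjSelmerAc (W.baseChange K) p κ 𝔭 ∅ γ - 1)),
          Nat.card (IwasawaDual.endInvariants (conjSelmerAc (W.baseChange K) p κ 𝔭 ∅ γ - 1)) =
            p ^ n * Nat.card (IwasawaDual.EndCoinvariants
              (conjSelmerAc (W.baseChange K) p κ 𝔭 ∅ γ - 1))) ∧
        (n : ℤ) = (padicValNat p
            (Nat.card (AddCommGroup.primaryComponent (W.baseChange K).sha p)) : ℤ) +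
          2 * ((padicLogOrd W p ι P - 1) - (padicValNat p (AddSubgroup.zmultiples P).index : ℤ)) +
            padicValNat p (tamagawaProductSplit W K) := by
  haveI := module_finite_XAc_baseChange p κ 𝔭 γ (W := W)
  unfold ControlOnTreeAt
  simp only [XAc.hasCharValuationAt_iff_card]

end Links


/-! ### Class level: route R1's two typed inputs in Euler-characteristic form -/

section ClassLevel

variable (W : WeierstrassCurve ℚ) [W.IsElliptic] [W.IsGloballyMinimal] (p : ℕ) [Fact p.Prime]

/-- **THE open input of route R1 in Euler-characteristic form.** `R1OpenInputOnTreeAt W p` (erratum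
Thm. 1.1 at `𝟙` ∘ Cas18 Thm. 3.2 at every datum, every symbol a tree object; OPEN) holds IF AND ONLY
IF at every datum and every anticyclotomic `κ`, topological generator `γ`, degree-one `𝔭 ∋ p`:
`Sel_𝔭(K_∞, E[p^∞])^γ` is finite and `#Sel_𝔭(K_∞, E[p^∞])^γ = p^n · #Sel_𝔭(K_∞, E[p^∞])_γ` with
`n = 2·(ord_p log_{ω_E} P_K − 1)` (`log` through THE embedding `embAt K p 𝔭`). Datum by datum this is
`imcWaldspurgerOnTreeAt_iff_card`. The open input is thus a family of identities between orders of
`H⁰(Γ, ·)` and `H¹(Γ, ·)` of Castella's Selmer groups and `p`-adic logarithms of Heegner points — no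
`Λ`-module structure, characteristic ideal, `p`-adic `L`-function or choice of generator appears.
UNREFEREED input; a reformulation, NOT a proof. [claim: Castella2018Erratum, status: under-review]
[cite: Castella2018, Thm. 3.2 (arXiv:1704.06608 p. 9) and §5 (5.1) (p. 12) (shape only; nothing asserted)] [cite: GreenbergLNM1716, §4 Lemma 4.2 (p. 102)] -/
theorem r1OpenInputOnTreeAt_iff_card :
    R1OpenInputOnTreeAt W p ↔
      ∀ [NeZero (W.conductorNorm ℤ)] (q : ℕ) [Fact q.Prime] (K : Type) [Field K] [NumberField K]
        (Dt : ModularParametrizationData W (W.conductorNorm ℤ))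
        (H : HeegnerDatum (W.conductorNorm ℤ) (NumberField.discr K)) (ι : K →+* ℂ)
        (P : (W.baseChange K).toAffine.Point),
        ErratumHypotheses W p → W.analyticRank = 1 → q ≠ p → Mult W q →
        ¬ W.HasSplitMultiplicativeReductionAtPrime q →
        ¬ p ∣ padicValInt q W.minimalDiscriminantInt →
        IsErratumField W K q → Cas20Standing K p (W.conductorNorm ℤ / p) →
        WeierstrassCurve.Affine.Point.map ι.toRatAlgHom P = heegnerPointComplex Dt H →
        ¬ (p : ℤ) ∣ Dt.c → ¬ IsOfFinAddOrder P →
        ∀ (κ : ZpExtension K p), κ.IsAnticyclotomic →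
          ∀ (γ : Field.absoluteGaloisGroup K) [Fact (κ.IsTopGenerator γ)]
            (𝔭 : HeightOneSpectrum (𝓞 K)) (h𝔭 : ((p : ℕ) : 𝓞 K) ∈ 𝔭.asIdeal)
            (he : 𝔭.asIdeal.ramificationIdx (𝓞 ℚ) = 1) (hf : 𝔭.asIdeal.inertiaDeg (𝓞 ℚ) = 1),
            ∃ n : ℕ, (∃ _ : Finite (IwasawaDual.endInvariants
                  (conjSelmerAc (W.baseChange K) p κ 𝔭 ∅ γ - 1)),
                Nat.card (IwasawaDual.endInvariants
                    (conjSelmerAc (W.baseChange K) p κ 𝔭 ∅ γ - 1)) =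
                  p ^ n * Nat.card (IwasawaDual.EndCoinvariants
                    (conjSelmerAc (W.baseChange K) p κ 𝔭 ∅ γ - 1))) ∧
              (n : ℤ) = 2 * (padicLogOrd W p (embAt K p 𝔭 h𝔭 he hf) P - 1) := by
  constructor
  · intro h _ q _ K _ _ Dt H ι P hE hr hqp hmq hns hvq hK hCas hP hc hinf κ hκ γ _ 𝔭 h𝔭 he hf
    exact (imcWaldspurgerOnTreeAt_iff_card p κ 𝔭 γ (embAt K p 𝔭 h𝔭 he hf) P).mp
      (h q K Dt H ι P hE hr hqp hmq hns hvq hK hCas hP hc hinf κ hκ γ 𝔭 h𝔭 he hf)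
  · intro h _ q _ K _ _ Dt H ι P hE hr hqp hmq hns hvq hK hCas hP hc hinf κ hκ γ _ 𝔭 h𝔭 he hf
    exact (imcWaldspurgerOnTreeAt_iff_card p κ 𝔭 γ (embAt K p 𝔭 h𝔭 he hf) P).mpr
      (h q K Dt H ι P hE hr hqp hmq hns hvq hK hCas hP hc hinf κ hκ γ 𝔭 h𝔭 he hf)

/-- **The control input of route R1 (Cas18 Thm. 2.3, PUB shape) in Euler-characteristic form**:
`R1ControlOnTreeAt W p` holds IFF at every datum `Sel_𝔭(K_∞, E[p^∞])^γ` is finite and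
`#Sel_𝔭(K_∞, E[p^∞])^γ = p^n · #Sel_𝔭(K_∞, E[p^∞])_γ` with
`n = ord_p #Ш(E/K)[p^∞] + 2·((ord_p log_ω P − 1) − ord_p[E(K):ℤP]) + ord_p ∏_{w∣N⁺} c_w(E/K)` —
datum by datum `controlOnTreeAt_iff_card`; the shape in which JSW17 Thm. 3.3.1 is stated and proved.
A reformulation of the typed input; nothing asserted.
[cite: Castella2018, Thm. 2.3 (arXiv:1704.06608 p. 5) (shape only; nothing asserted)] [cite: JetchevSkinnerWan2017, Thm. 3.3.1 (shape only; nothing asserted)] -/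
theorem r1ControlOnTreeAt_iff_card :
    R1ControlOnTreeAt W p ↔
      ∀ [NeZero (W.conductorNorm ℤ)] (q : ℕ) [Fact q.Prime] (K : Type) [Field K] [NumberField K]
        (Dt : ModularParametrizationData W (W.conductorNorm ℤ))
        (H : HeegnerDatum (W.conductorNorm ℤ) (NumberField.discr K)) (ι : K →+* ℂ)
        (P : (W.baseChange K).toAffine.Point),
        ErratumHypotheses W p → W.analyticRank = 1 → q ≠ p → Mult W q →
        ¬ W.HasSplitMultiplicativeReductionAtPrime q →
        ¬ p ∣ padicValInt q W.minimalDiscriminantInt →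
        IsErratumField W K q → Cas20Standing K p (W.conductorNorm ℤ / p) →
        WeierstrassCurve.Affine.Point.map ι.toRatAlgHom P = heegnerPointComplex Dt H →
        ¬ (p : ℤ) ∣ Dt.c → ¬ IsOfFinAddOrder P →
        ∀ (κ : ZpExtension K p), κ.IsAnticyclotomic →
          ∀ (γ : Field.absoluteGaloisGroup K) [Fact (κ.IsTopGenerator γ)]
            (𝔭 : HeightOneSpectrum (𝓞 K)) (h𝔭 : ((p : ℕ) : 𝓞 K) ∈ 𝔭.asIdeal)
            (he : 𝔭.asIdeal.ramificationIdx (𝓞 ℚ) = 1) (hf : 𝔭.asIdeal.inertiaDeg (𝓞 ℚ) = 1),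
            ∃ n : ℕ, (∃ _ : Finite (IwasawaDual.endInvariants
                  (conjSelmerAc (W.baseChange K) p κ 𝔭 ∅ γ - 1)),
                Nat.card (IwasawaDual.endInvariants
                    (conjSelmerAc (W.baseChange K) p κ 𝔭 ∅ γ - 1)) =
                  p ^ n * Nat.card (IwasawaDual.EndCoinvariants
                    (conjSelmerAc (W.baseChange K) p κ 𝔭 ∅ γ - 1))) ∧
              (n : ℤ) = (padicValNat p
                  (Nat.card (AddCommGroup.primaryComponent (W.baseChange K).sha p)) : ℤ) +
                2 * ((padicLogOrd W p (embAt K p 𝔭 h𝔭 he hf) P - 1) -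
                  (padicValNat p (AddSubgroup.zmultiples P).index : ℤ)) +
                padicValNat p (tamagawaProductSplit W K) := by
  constructor
  · intro h _ q _ K _ _ Dt H ι P hE hr hqp hmq hns hvq hK hCas hP hc hinf κ hκ γ _ 𝔭 h𝔭 he hf
    exact (controlOnTreeAt_iff_card p κ 𝔭 γ (embAt K p 𝔭 h𝔭 he hf) P).mp
      (h q K Dt H ι P hE hr hqp hmq hns hvq hK hCas hP hc hinf κ hκ γ 𝔭 h𝔭 he hf)
  · intro h _ q _ K _ _ Dt H ι P hE hr hqp hmq hns hvq hK hCas hP hc hinf κ hκ γ _ 𝔭 h𝔭 he hf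
    exact (controlOnTreeAt_iff_card p κ 𝔭 γ (embAt K p 𝔭 h𝔭 he hf) P).mpr
      (h q K Dt H ι P hE hr hqp hmq hns hvq hK hCas hP hc hinf κ hκ γ 𝔭 h𝔭 he hf)

end ClassLevel

end Summit.BirchSwinnertonDyer.Rank1Residual.X11b

end
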